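import Summits.Ventures.PercRepro.S1FourCircuitW
import Summits.Ventures.PercRepro.S1TriangleV

/-!
# PercRepro — LEMMA W′: the four-circuits and the triangles together, `8·s₄ + 2n·s₃ ≤ n(n−1)(n−2)` under (C1), (C2)
(p2, gen 18)

LEMMA W (`S1FourCircuitW`) counts the four-circuits through two points `a, b` by their third points `c`: at most `3`
four-circuits contain `a, b, c`, the fourth point lying in the plane `cl {a, b, c}` (≤ 6 points by (C2)) outside
`{a, b, c}`. When the pair `{a, b}` lies on a triangle `T = {a, b, e}` the count improves: `c = e` lies in no
four-circuit with `a, b` (a circuit contains no circuit), and for `c ∉ T` the fourth point also avoids `e ∈ cl {a, b}`,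
so at most `2` four-circuits contain `a, b, c`. Hence `2·#{C ∋ a, b} ≤ 2(n − 3)` for a covered pair against
`3(n − 2)` for an uncovered one — in one line, `2·#{C ∋ a, b} + n·#{T ∋ a, b} ≤ 3(n − 2)` (`#{T ∋ a, b} ≤ 1` by (C1)).
Summing over the `n(n − 1)` ordered pairs, with `Σ #{C ∋ a, b} = 12·s₄` and `Σ #{T ∋ a, b} = 6·s₃`:
`24·s₄ + 6n·s₃ ≤ 3n(n − 1)(n − 2)`, i.e. **`8·s₄ + 2n·s₃ ≤ n(n − 1)(n − 2)`** — a joint constraint on the two circuit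
counts, tight on `U_{3,6}` (`s₃ = 0`, `s₄ = 15`; on `M(K₄)` it reads `24 + 48 ≤ 120`). In a cell `(p, d)` of the
`q = 4` window with `n = p + d` it bounds `s₄` by
`⌊(n(n−1)(n−2) − 2n·s₃)/8⌋` for the ACTUAL `s₃`: at `n = 33` the pairs `(s₃, s₄)` with `s₃ ≤ 121` (LEMMA V) all pass
the cell inequality `cellOK10 8 25 s₃ S(s₃)` — the cell `(8, 25)` closes.

* `finite_triangles` — the triangles form a finite set;
* `card_filter_triangles_pair_le_one` — at most one triangle through two given points (under (C1));
* `card_filter_fourCircuits_three_eq_zero_of_mem` — no four-circuit contains a triangle;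
* `card_filter_fourCircuits_three_le_two` — at most two four-circuits through `a, b, c` when `{a, b}` lies on a
  triangle avoiding `c`;
* `two_mul_card_filter_fourCircuits_pair_add_le` — `2·#{C ∋ a, b} + n·#{T ∋ a, b} ≤ 3(n − 2)`;
* **`eight_mul_ncard_fourCircuits_add_le`** — `8·s₄ + 2n·s₃ ≤ n(n − 1)(n − 2)` under (C1), (C2);
* **`core_eight_mul_ncard_fourCircuits_add_le`** — the same on the `e`-free core.
Axioms: standard.
-/

open scoped Matroid

namespace PercRepro

namespace S1

open Set

variable {α : Type}

/-- The triangles of a finite matroid form a finite set. -/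
theorem finite_triangles (M : Matroid α) [M.Finite] : (ThmN.triangles M).Finite :=
  M.ground_finite.finite_subsets.subset (fun _ hC => hC.1.subset_ground)

open Classical in
/-- **At most one triangle through two given points** (under (C1)). -/
theorem card_filter_triangles_pair_le_one (M : Matroid α) [M.Finite]
    (hC1 : ∀ L ⊆ M.E, M.eRk L = 2 → L.ncard ≤ 3) {a b : α} (hab : a ≠ b) :
    ((finite_triangles M).toFinset.filter (fun T => a ∈ T ∧ b ∈ T)).card ≤ 1 := by
  rw [Finset.card_le_one]
  intro T hT T' hT'
  rw [Finset.mem_filter, Set.Finite.mem_toFinset] at hT hT'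
  exact eq_of_mem_trianglesThrough_of_mem M hC1 (x := a) (y := b) ⟨hT.1.1, hT.1.2, hT.2.1⟩
    ⟨hT'.1.1, hT'.1.2, hT'.2.1⟩ hT.2.2 hT'.2.2 hab.symm

open Classical in
/-- **No four-circuit contains a triangle**: if `{a, b, c}` is a triangle, no four-circuit contains `a, b, c`. -/
theorem card_filter_fourCircuits_three_eq_zero_of_mem (M : Matroid α) [M.Finite] {a b c : α} {T : Set α}
    (hT : T ∈ ThmN.triangles M) (haT : a ∈ T) (hbT : b ∈ T) (hcT : c ∈ T) (hab : a ≠ b) (hac : a ≠ c)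
    (hbc : b ≠ c) :
    ((finite_fourCircuits M).toFinset.filter (fun C => (a ∈ C ∧ b ∈ C) ∧ c ∈ C)).card = 0 := by
  rw [Finset.card_eq_zero, Finset.filter_eq_empty_iff]
  intro C hC hmem
  rw [Set.Finite.mem_toFinset] at hC
  obtain ⟨⟨haC, hbC⟩, hcC⟩ := hmem
  have hTfin : T.Finite := M.ground_finite.subset hT.1.subset_ground
  have hTeq : ({a, b, c} : Set α) = T := by
    refine Set.eq_of_subset_of_ncard_le ?_ ?_ hTfin
    · intro z hz
      rcases hz with rfl | rfl | rfl
      exacts [haT, hbT, hcT]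
    · rw [hT.2, Set.ncard_insert_of_notMem (by simp [hab, hac]), Set.ncard_pair hbc]
  have hsub : T ⊆ C := by
    rw [← hTeq]
    intro z hz
    rcases hz with rfl | rfl | rfl
    exacts [haC, hbC, hcC]
  have hTC : T ⊂ C := hsub.ssubset_of_ne (by
    intro h
    have h3 := hT.2
    rw [h, hC.2] at h3
    omega)
  exact hT.1.dep.not_indep (hC.1.ssubset_indep hTC)

open Classical in
/-- **At most two four-circuits through `a, b, c`** when the pair `{a, b}` lies on a triangle `T` not containing
`c` (under (C2)): the fourth point lies in the plane `cl {a, b, c}`, which also contains the third point of `T`,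
outside `{a, b, c}` and that point. -/
theorem card_filter_fourCircuits_three_le_two (M : Matroid α) [M.Finite]
    (hC2 : ∀ P ⊆ M.E, M.eRk P ≤ 3 → P.ncard ≤ 6) {a b c e : α} {T : Set α} (hT : T ∈ ThmN.triangles M)
    (haT : a ∈ T) (hbT : b ∈ T) (heT : e ∈ T) (hcE : c ∈ M.E) (hcT : c ∉ T) (hab : a ≠ b) (hae : a ≠ e)
    (hbe : b ≠ e) :
    ((finite_fourCircuits M).toFinset.filter (fun C => (a ∈ C ∧ b ∈ C) ∧ c ∈ C)).card ≤ 2 := by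
  have hTE : T ⊆ M.E := hT.1.subset_ground
  have hTfin : T.Finite := M.ground_finite.subset hTE
  have haE : a ∈ M.E := hTE haT
  have hbE : b ∈ M.E := hTE hbT
  have hac : a ≠ c := fun h => hcT (h ▸ haT)
  have hbc : b ≠ c := fun h => hcT (h ▸ hbT)
  have hce : c ≠ e := fun h => hcT (h ▸ heT)
  have hTeq : ({a, b, e} : Set α) = T := by
    refine Set.eq_of_subset_of_ncard_le ?_ ?_ hTfin
    · intro z hz
      rcases hz with rfl | rfl | rfl
      exacts [haT, hbT, heT]
    · rw [hT.2, Set.ncard_insert_of_notMem (by simp [hab, hae]), Set.ncard_pair hbe]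
  set X : Set α := {a, b, c} with hX
  have hXE : X ⊆ M.E := by
    intro z hz
    rcases hz with rfl | rfl | rfl
    exacts [haE, hbE, hcE]
  have hXcard : X.ncard = 3 := by
    rw [hX, Set.ncard_insert_of_notMem (by simp [hab, hac]), Set.ncard_pair hbc]
  have hXfin : X.Finite := M.ground_finite.subset hXE
  have hclE : M.closure X ⊆ M.E := M.closure_subset_ground X
  have hclfin : (M.closure X).Finite := M.ground_finite.subset hclE
  have hclr : M.eRk (M.closure X) ≤ 3 := by
    rw [M.eRk_closure_eq]
    calc M.eRk X ≤ X.encard := M.eRk_le_encard X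
      _ = ((X.ncard : ℕ) : ℕ∞) := by rw [hXfin.cast_ncard_eq]
      _ = 3 := by rw [hXcard]; rfl
  have hcl6 : (M.closure X).ncard ≤ 6 := hC2 _ hclE hclr
  have hXcl : X ⊆ M.closure X := M.subset_closure X hXE
  -- `e ∈ cl {a, b} ⊆ cl X`
  have hecl : e ∈ M.closure X := by
    have h := hT.1.mem_closure_sdiff_singleton_of_mem heT
    refine M.closure_subset_closure ?_ h
    intro z hz
    rw [← hTeq] at hz
    obtain ⟨hz1, hz2⟩ := hz
    rcases hz1 with rfl | rfl | rfl
    · exact Set.mem_insert _ _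
    · exact Set.mem_insert_of_mem _ (Set.mem_insert _ _)
    · exact (hz2 (Set.mem_singleton _)).elim
  have heX : e ∉ X := by
    intro h
    rcases h with rfl | rfl | rfl
    · exact hae rfl
    · exact hbe rfl
    · exact hce rfl
  have hY : insert e X ⊆ M.closure X := Set.insert_subset hecl hXcl
  have hYcard : (insert e X).ncard = 4 := by
    rw [Set.ncard_insert_of_notMem heX hXfin, hXcard]
  have hYfin : (insert e X).Finite := hXfin.insert e
  have hTarget : (M.closure X \ insert e X).ncard ≤ 2 := by
    rw [Set.ncard_sdiff' hY hclfin, hYcard]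
    omega
  have hTfin' : (M.closure X \ insert e X).Finite := hclfin.subset Set.sdiff_subset
  have hTcard : hTfin'.toFinset.card = (M.closure X \ insert e X).ncard :=
    (Set.ncard_eq_toFinset_card _ _).symm
  refine (Finset.card_le_card_of_surjOn (fun d => insert d X) ?_).trans (by rw [hTcard]; exact hTarget)
  intro C hC
  rw [Finset.mem_coe, Finset.mem_filter, Set.Finite.mem_toFinset] at hC
  obtain ⟨⟨hCc, hC4⟩, ⟨haC, hbC⟩, hcC⟩ := hC
  have hXC : X ⊆ C := by
    intro z hz
    rcases hz with rfl | rfl | rfl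
    exacts [haC, hbC, hcC]
  have hCfin : C.Finite := M.ground_finite.subset hCc.subset_ground
  obtain ⟨d, hdC, hdX⟩ : ∃ d, d ∈ C ∧ d ∉ X :=
    Set.exists_mem_notMem_of_ncard_lt_ncard (by rw [hXcard, hC4]; norm_num) hXfin
  have hCeq : insert d X = C := by
    refine Set.eq_of_subset_of_ncard_le (Set.insert_subset hdC hXC) ?_ hCfin
    rw [hC4, Set.ncard_insert_of_notMem hdX hXfin, hXcard]
  refine ⟨d, ?_, hCeq⟩
  rw [Finset.mem_coe, Set.Finite.mem_toFinset]
  refine ⟨?_, ?_⟩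
  · have h := hCc.mem_closure_sdiff_singleton_of_mem hdC
    refine M.closure_subset_closure ?_ h
    intro z hz
    rw [← hCeq] at hz
    obtain ⟨hz1, hz2⟩ := hz
    rcases hz1 with rfl | hz1
    · exact (hz2 (Set.mem_singleton _)).elim
    · exact hz1
  · -- `d ∉ insert e X`: `d ∉ X`, and `d ≠ e` since `e ∈ C` would put the triangle `T` inside `C`
    intro hd
    rcases hd with rfl | hd
    · -- `d = e`: then `T = {a, b, e} ⊆ C`, a circuit inside a circuit
      have hsub : T ⊆ C := by
        rw [← hTeq]
        intro z hz
        rcases hz with rfl | rfl | rfl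
        exacts [haC, hbC, hdC]
      have hTC : T ⊂ C := hsub.ssubset_of_ne (by
        intro h
        have h3 := hT.2
        rw [h, hC4] at h3
        omega)
      exact hT.1.dep.not_indep (hCc.ssubset_indep hTC)
    · exact hdX hd

open Classical in
/-- **The refined pair count**: `2·#{C ∋ a, b} + n·#{T ∋ a, b} ≤ 3(n − 2)` for distinct points `a, b` (under
(C1), (C2)) — LEMMA W's bound for an uncovered pair, `2(n − 3)` for a pair on a triangle. -/
theorem two_mul_card_filter_fourCircuits_pair_add_le (M : Matroid α) [M.Finite]
    (hC1 : ∀ L ⊆ M.E, M.eRk L = 2 → L.ncard ≤ 3) (hC2 : ∀ P ⊆ M.E, M.eRk P ≤ 3 → P.ncard ≤ 6)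
    {a b : α} (haE : a ∈ M.E) (hbE : b ∈ M.E) (hab : a ≠ b) :
    2 * ((finite_fourCircuits M).toFinset.filter (fun C => a ∈ C ∧ b ∈ C)).card +
      M.E.ncard * ((finite_triangles M).toFinset.filter (fun T => a ∈ T ∧ b ∈ T)).card ≤
      3 * (M.E.ncard - 2) := by
  classical
  have hmemE : ∀ x, x ∈ M.ground_finite.toFinset ↔ x ∈ M.E := fun x => Set.Finite.mem_toFinset _
  have hEcard : M.ground_finite.toFinset.card = M.E.ncard := (Set.ncard_eq_toFinset_card _ _).symm
  set TT := (finite_triangles M).toFinset.filter (fun T => a ∈ T ∧ b ∈ T) with hTT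
  have hTT1 : TT.card ≤ 1 := card_filter_triangles_pair_le_one M hC1 hab
  rcases Nat.eq_zero_or_pos TT.card with h0 | hpos
  · rw [h0, mul_zero, add_zero]
    exact two_mul_card_filter_fourCircuits_pair_le M hC2 haE hbE hab
  · have hTTcard : TT.card = 1 := by omega
    -- the triangle `T = {a, b, e}` through `a, b`
    obtain ⟨T, hTmem⟩ : TT.Nonempty := Finset.card_pos.1 hpos
    rw [hTT, Finset.mem_filter, Set.Finite.mem_toFinset] at hTmem
    obtain ⟨hT, haT, hbT⟩ := hTmem
    have hTE : T ⊆ M.E := hT.1.subset_ground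
    have hTfin : T.Finite := M.ground_finite.subset hTE
    obtain ⟨e, heT, heab⟩ : ∃ e, e ∈ T ∧ e ∉ ({a, b} : Set α) :=
      Set.exists_mem_notMem_of_ncard_lt_ncard (by rw [hT.2, Set.ncard_pair hab]; norm_num)
    have hae : a ≠ e := fun h => heab (by rw [← h]; exact Set.mem_insert _ _)
    have hbe : b ≠ e := fun h => heab (by rw [← h]; exact Set.mem_insert_of_mem _ (Set.mem_singleton _))
    have heE : e ∈ M.E := hTE heT
    -- the count of the four-circuits through `a, b`, by their third points
    set G := (finite_fourCircuits M).toFinset.filter (fun C => a ∈ C ∧ b ∈ C) with hG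
    have hGmem : ∀ C ∈ G, C ⊆ M.E ∧ C.ncard = 4 := by
      intro C hC
      rw [hG, Finset.mem_filter, Set.Finite.mem_toFinset] at hC
      exact ⟨hC.1.1.subset_ground, hC.1.2⟩
    have hsum := sum_card_filter_mem M G 4 hGmem
    have haEf : a ∈ M.ground_finite.toFinset := (hmemE a).2 haE
    have hbEf : b ∈ M.ground_finite.toFinset.erase a := Finset.mem_erase.2 ⟨hab.symm, (hmemE b).2 hbE⟩
    have heEf : e ∈ (M.ground_finite.toFinset.erase a).erase b :=
      Finset.mem_erase.2 ⟨hbe.symm, Finset.mem_erase.2 ⟨hae.symm, (hmemE e).2 heE⟩⟩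
    have h1 : ∑ x ∈ M.ground_finite.toFinset, (G.filter (fun C => x ∈ C)).card =
        (G.filter (fun C => a ∈ C)).card +
          ∑ x ∈ M.ground_finite.toFinset.erase a, (G.filter (fun C => x ∈ C)).card :=
      (Finset.add_sum_erase _ (fun x => (G.filter (fun C => x ∈ C)).card) haEf).symm
    have h2 : ∑ x ∈ M.ground_finite.toFinset.erase a, (G.filter (fun C => x ∈ C)).card =
        (G.filter (fun C => b ∈ C)).card +
          ∑ x ∈ (M.ground_finite.toFinset.erase a).erase b, (G.filter (fun C => x ∈ C)).card :=
      (Finset.add_sum_erase _ (fun x => (G.filter (fun C => x ∈ C)).card) hbEf).symm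
    have h3 : ∑ x ∈ (M.ground_finite.toFinset.erase a).erase b, (G.filter (fun C => x ∈ C)).card =
        (G.filter (fun C => e ∈ C)).card +
          ∑ x ∈ ((M.ground_finite.toFinset.erase a).erase b).erase e, (G.filter (fun C => x ∈ C)).card :=
      (Finset.add_sum_erase _ (fun x => (G.filter (fun C => x ∈ C)).card) heEf).symm
    have hGa : (G.filter (fun C => a ∈ C)).card = G.card := by
      rw [Finset.filter_true_of_mem]
      intro C hC
      rw [hG, Finset.mem_filter] at hC
      exact hC.2.1
    have hGb : (G.filter (fun C => b ∈ C)).card = G.card := by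
      rw [Finset.filter_true_of_mem]
      intro C hC
      rw [hG, Finset.mem_filter] at hC
      exact hC.2.2
    have hGe : (G.filter (fun C => e ∈ C)).card = 0 := by
      rw [hG, Finset.filter_filter]
      exact card_filter_fourCircuits_three_eq_zero_of_mem M hT haT hbT heT hab hae hbe
    rw [h1, h2, h3, hGa, hGb, hGe] at hsum
    have hrest : ∑ c ∈ ((M.ground_finite.toFinset.erase a).erase b).erase e,
        (G.filter (fun C => c ∈ C)).card ≤
        ∑ _c ∈ ((M.ground_finite.toFinset.erase a).erase b).erase e, 2 := by
      apply Finset.sum_le_sum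
      intro c hc
      rw [Finset.mem_erase, Finset.mem_erase, Finset.mem_erase] at hc
      obtain ⟨hce, hcb, hca, hcE⟩ := hc
      have hcT : c ∉ T := by
        intro hcT
        have hTeq : ({a, b, e} : Set α) = T := by
          refine Set.eq_of_subset_of_ncard_le ?_ ?_ hTfin
          · intro z hz
            rcases hz with rfl | rfl | rfl
            exacts [haT, hbT, heT]
          · rw [hT.2, Set.ncard_insert_of_notMem (by simp [hab, hae]), Set.ncard_pair hbe]
        rw [← hTeq] at hcT
        rcases hcT with h | h | h
        · exact hca h
        · exact hcb h
        · exact hce h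
      rw [hG, Finset.filter_filter]
      exact card_filter_fourCircuits_three_le_two M hC2 hT haT hbT heT ((hmemE c).1 hcE) hcT hab hae hbe
    rw [Finset.sum_const, smul_eq_mul, Finset.card_erase_of_mem heEf, Finset.card_erase_of_mem hbEf,
      Finset.card_erase_of_mem haEf, hEcard] at hrest
    rw [hTTcard, mul_one]
    -- hsum : G.card + (G.card + (0 + Σ rest)) = 4 * G.card ; hrest : Σ rest ≤ (n - 1 - 1 - 1) * 2 ; n ≥ 3
    have hn3 : 3 ≤ M.E.ncard := by
      have := Set.ncard_le_ncard hTE M.ground_finite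
      rw [hT.2] at this
      exact this
    omega

open Classical in
/-- **LEMMA W′**: under (C1) and (C2), `8·s₄ + 2n·s₃ ≤ n(n − 1)(n − 2)`. -/
theorem eight_mul_ncard_fourCircuits_add_le (M : Matroid α) [M.Finite]
    (hC1 : ∀ L ⊆ M.E, M.eRk L = 2 → L.ncard ≤ 3) (hC2 : ∀ P ⊆ M.E, M.eRk P ≤ 3 → P.ncard ≤ 6) :
    8 * (fourCircuits M).ncard + 2 * M.E.ncard * (ThmN.triangles M).ncard ≤
      M.E.ncard * (M.E.ncard - 1) * (M.E.ncard - 2) := by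
  classical
  have hmemE : ∀ x, x ∈ M.ground_finite.toFinset ↔ x ∈ M.E := fun x => Set.Finite.mem_toFinset _
  have hEcard : M.ground_finite.toFinset.card = M.E.ncard := (Set.ncard_eq_toFinset_card _ _).symm
  set F4 := (finite_fourCircuits M).toFinset with hF4
  set F3 := (finite_triangles M).toFinset with hF3
  have hF4n : (fourCircuits M).ncard = F4.card := Set.ncard_eq_toFinset_card _ _
  have hF3n : (ThmN.triangles M).ncard = F3.card := Set.ncard_eq_toFinset_card _ _
  -- per point `a`: the sums over `b ≠ a`
  have hpoint : ∀ a ∈ M.ground_finite.toFinset,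
      2 * (3 * (F4.filter (fun C => a ∈ C)).card) + M.E.ncard * (2 * (F3.filter (fun T => a ∈ T)).card) ≤
        (M.E.ncard - 1) * (3 * (M.E.ncard - 2)) := by
    intro a ha
    have haE : a ∈ M.E := (hmemE a).1 ha
    set H := F4.filter (fun C => a ∈ C) with hH
    set K := F3.filter (fun T => a ∈ T) with hK
    have hHmem : ∀ C ∈ H, C ⊆ M.E ∧ C.ncard = 4 := by
      intro C hC
      rw [hH, Finset.mem_filter, hF4, Set.Finite.mem_toFinset] at hC
      exact ⟨hC.1.1.subset_ground, hC.1.2⟩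
    have hKmem : ∀ T ∈ K, T ⊆ M.E ∧ T.ncard = 3 := by
      intro T hT
      rw [hK, Finset.mem_filter, hF3, Set.Finite.mem_toFinset] at hT
      exact ⟨hT.1.1.subset_ground, hT.1.2⟩
    have hsumH := sum_card_filter_mem M H 4 hHmem
    have hsumK := sum_card_filter_mem M K 3 hKmem
    have h1 : ∑ x ∈ M.ground_finite.toFinset, (H.filter (fun C => x ∈ C)).card =
        (H.filter (fun C => a ∈ C)).card +
          ∑ x ∈ M.ground_finite.toFinset.erase a, (H.filter (fun C => x ∈ C)).card :=
      (Finset.add_sum_erase _ (fun x => (H.filter (fun C => x ∈ C)).card) ha).symm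
    have h2 : ∑ x ∈ M.ground_finite.toFinset, (K.filter (fun T => x ∈ T)).card =
        (K.filter (fun T => a ∈ T)).card +
          ∑ x ∈ M.ground_finite.toFinset.erase a, (K.filter (fun T => x ∈ T)).card :=
      (Finset.add_sum_erase _ (fun x => (K.filter (fun T => x ∈ T)).card) ha).symm
    have hHa : (H.filter (fun C => a ∈ C)).card = H.card := by
      rw [Finset.filter_true_of_mem]
      intro C hC
      rw [hH, Finset.mem_filter] at hC
      exact hC.2
    have hKa : (K.filter (fun T => a ∈ T)).card = K.card := by
      rw [Finset.filter_true_of_mem]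
      intro T hT
      rw [hK, Finset.mem_filter] at hT
      exact hT.2
    rw [h1, hHa] at hsumH
    rw [h2, hKa] at hsumK
    have hpair : ∑ b ∈ M.ground_finite.toFinset.erase a,
        (2 * (H.filter (fun C => b ∈ C)).card + M.E.ncard * (K.filter (fun T => b ∈ T)).card) ≤
        ∑ _b ∈ M.ground_finite.toFinset.erase a, 3 * (M.E.ncard - 2) := by
      apply Finset.sum_le_sum
      intro b hb
      rw [Finset.mem_erase] at hb
      obtain ⟨hba, hbE⟩ := hb
      rw [hH, hK, Finset.filter_filter, Finset.filter_filter]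
      exact two_mul_card_filter_fourCircuits_pair_add_le M hC1 hC2 haE ((hmemE b).1 hbE) (Ne.symm hba)
    rw [Finset.sum_add_distrib, ← Finset.mul_sum, ← Finset.mul_sum, Finset.sum_const, smul_eq_mul,
      Finset.card_erase_of_mem ha, hEcard] at hpair
    have hH3 : ∑ x ∈ M.ground_finite.toFinset.erase a, (H.filter (fun C => x ∈ C)).card = 3 * H.card := by
      omega
    have hK2 : ∑ x ∈ M.ground_finite.toFinset.erase a, (K.filter (fun T => x ∈ T)).card = 2 * K.card := by
      omega
    rw [hH3, hK2] at hpair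
    exact hpair
  have htot := Finset.sum_le_sum hpoint
  rw [Finset.sum_add_distrib, ← Finset.mul_sum, ← Finset.mul_sum, ← Finset.mul_sum, ← Finset.mul_sum,
    Finset.sum_const, smul_eq_mul, hEcard] at htot
  have hsum4 := sum_card_filter_mem M F4 4 (fun C hC => by
    rw [hF4, Set.Finite.mem_toFinset] at hC
    exact ⟨hC.1.subset_ground, hC.2⟩)
  have hsum3 := sum_card_filter_mem M F3 3 (fun T hT => by
    rw [hF3, Set.Finite.mem_toFinset] at hT
    exact ⟨hT.1.subset_ground, hT.2⟩)
  rw [hsum4, hsum3] at htot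
  -- htot : 2 * (3 * (4 * F4.card)) + n * (2 * (3 * F3.card)) ≤ n * ((n - 1) * (3 * (n - 2)))
  rw [hF4n, hF3n]
  have h3 : 3 * (8 * F4.card + 2 * M.E.ncard * F3.card) ≤
      3 * (M.E.ncard * (M.E.ncard - 1) * (M.E.ncard - 2)) := by
    calc 3 * (8 * F4.card + 2 * M.E.ncard * F3.card)
        = 2 * (3 * (4 * F4.card)) + M.E.ncard * (2 * (3 * F3.card)) := by ring
      _ ≤ M.E.ncard * ((M.E.ncard - 1) * (3 * (M.E.ncard - 2))) := htot
      _ = 3 * (M.E.ncard * (M.E.ncard - 1) * (M.E.ncard - 2)) := by ring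
  exact Nat.le_of_mul_le_mul_left h3 (by norm_num)

/-- **LEMMA W′ on the `e`-free core**, in the set-builder vocabulary of `S1RowTwelve`:
`8·s₄ + 2n·s₃ ≤ n(n − 1)(n − 2)`. -/
theorem core_eight_mul_ncard_fourCircuits_add_le (M : Matroid α) [M.Finite]
    (hfree : ∀ e ∈ M.E, ∃ A ⊆ M.E \ {e}, e ∉ M.closure A ∧ e ∉ M.closure ((M.E \ {e}) \ A)) :
    8 * {C : Set α | M.IsCircuit C ∧ C.ncard = 4}.ncard +
        2 * M.E.ncard * {C : Set α | M.IsCircuit C ∧ C.ncard = 3}.ncard ≤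
      M.E.ncard * (M.E.ncard - 1) * (M.E.ncard - 2) := by
  have hL : ∀ e ∈ M.E, ¬ M.IsLoop e := ThmN.not_isLoop_of_free M hfree
  have hline : ∀ L ⊆ M.E, M.eRk L = 2 → L.ncard ≤ 3 := by
    intro L hL' hr
    have := ThmN.ncard_add_one_le_two_pow_of_eRk_le M hL hfree 2 L hL' hr.le
    omega
  have hplane : ∀ P ⊆ M.E, M.eRk P ≤ 3 → P.ncard ≤ 6 := fun P hP hr =>
    ThmN.ncard_le_six_of_eRk_le_three_of_free M hfree hP hr
  exact eight_mul_ncard_fourCircuits_add_le M hline hplane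

end S1

end PercRepro
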